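import Mathlib

/-!
# `TateLifting`, line `Sketch`, stub `stub_gramInvariant` — Gram invariance

Crux stmt-KontsevichZagierPeriods-9129 (`Summit.KontsevichZagierPeriods.KontsevichZagierPeriods.Theses.InverseLandau.TateLifting`).
The input of the `O(3)` engine for hard-sphere cluster integrals: a set `σ ⊆ (ℝ³)³` of three-point
configurations `x₂ = (x 0, x 1, x 2)`, `x₃ = (x 3, x 4, x 5)`, `x₄ = (x 6, x 7, x 8)` whose membership
is read off the Gram data `(|x₂|², |x₃|², |x₄|², x₂·x₃, x₂·x₄, x₃·x₄) ∈ G` is invariant under the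
diagonal action of every orthogonal `3 × 3` matrix `R` (`Rᵀ R = 1`), because orthogonal maps preserve
dot products: `(R u) ⬝ᵥ (R v) = u ᵥ* (Rᵀ R) ⬝ᵥ v = u ⬝ᵥ v`. The statement is the literal unfolding of
the skeleton's `GramInvariant` (with its local abbreviation `O3Invariant σ` written out).
-/

namespace Summit.KontsevichZagierPeriods.InverseLandau

/-- Orthogonal matrices (`Rᵀ R = 1`) preserve the dot product: `(R u) ⬝ᵥ (R v) = u ⬝ᵥ v`. [folklore] -/
theorem tateLifting_dotProduct_mulVec_mulVec_of_orthogonal {n : Type*} [Fintype n] [DecidableEq n]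
    {R : Matrix n n ℝ} (hR : R.transpose * R = 1) (u v : n → ℝ) :
    R.mulVec u ⬝ᵥ R.mulVec v = u ⬝ᵥ v := by
  rw [Matrix.dotProduct_mulVec, ← Matrix.vecMul_transpose, Matrix.vecMul_vecMul, hR,
    Matrix.vecMul_one]

/-- Orthogonal matrices preserve the dot product of two vectors of `ℝ³`, written out in coordinates:
`Σᵢ (R u)ᵢ (R v)ᵢ = u₀ v₀ + u₁ v₁ + u₂ v₂`. [folklore] -/
theorem tateLifting_mulVec_dot_mulVec_fin_three {R : Matrix (Fin 3) (Fin 3) ℝ}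
    (hR : R.transpose * R = 1) (u₀ u₁ u₂ v₀ v₁ v₂ : ℝ) :
    (R.mulVec ![u₀, u₁, u₂]) 0 * (R.mulVec ![v₀, v₁, v₂]) 0 +
      (R.mulVec ![u₀, u₁, u₂]) 1 * (R.mulVec ![v₀, v₁, v₂]) 1 +
      (R.mulVec ![u₀, u₁, u₂]) 2 * (R.mulVec ![v₀, v₁, v₂]) 2 = u₀ * v₀ + u₁ * v₁ + u₂ * v₂ := by
  have h := tateLifting_dotProduct_mulVec_mulVec_of_orthogonal hR ![u₀, u₁, u₂] ![v₀, v₁, v₂]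
  rwa [Matrix.vec3_dotProduct, Matrix.vec3_dotProduct'] at h

/-- **Gram invariance** (stub `stub_gramInvariant` of line `Sketch` for crux `TateLifting`): a set of
three-point configurations in `(ℝ³)³` whose membership is decided by the Gram data
`(|x₂|², |x₃|², |x₄|², x₂·x₃, x₂·x₄, x₃·x₄)` is invariant under the diagonal action of `O(3)`. [folklore] -/
theorem tateLifting_gramInvariant :
    ∀ (σ : Set (Fin 9 → ℝ)) (G : Set (Fin 6 → ℝ)),
      (∀ x : Fin 9 → ℝ, x ∈ σ ↔ (![x 0 ^ 2 + x 1 ^ 2 + x 2 ^ 2, x 3 ^ 2 + x 4 ^ 2 + x 5 ^ 2,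
          x 6 ^ 2 + x 7 ^ 2 + x 8 ^ 2, x 0 * x 3 + x 1 * x 4 + x 2 * x 5,
          x 0 * x 6 + x 1 * x 7 + x 2 * x 8, x 3 * x 6 + x 4 * x 7 + x 5 * x 8] : Fin 6 → ℝ) ∈ G) →
      ∀ R : Matrix (Fin 3) (Fin 3) ℝ, R.transpose * R = 1 → ∀ x : Fin 9 → ℝ,
        x ∈ σ ↔ (![(R.mulVec ![x 0, x 1, x 2]) 0, (R.mulVec ![x 0, x 1, x 2]) 1,
          (R.mulVec ![x 0, x 1, x 2]) 2,
          (R.mulVec ![x 3, x 4, x 5]) 0, (R.mulVec ![x 3, x 4, x 5]) 1, (R.mulVec ![x 3, x 4, x 5]) 2,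
          (R.mulVec ![x 6, x 7, x 8]) 0, (R.mulVec ![x 6, x 7, x 8]) 1, (R.mulVec ![x 6, x 7, x 8]) 2] :
            Fin 9 → ℝ) ∈ σ := by
  intro σ G hσ R hR x
  rw [hσ, hσ]
  simp only [Matrix.cons_val_zero, Matrix.cons_val_one, Matrix.cons_val, pow_two,
    tateLifting_mulVec_dot_mulVec_fin_three hR]

end Summit.KontsevichZagierPeriods.InverseLandau
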